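import Summits.CriticalPhenomena.PercolationContinuityZ3.Theorems.PercNearOneGluingNoHeavyLowerTailTformGluingResidual
import HarnessLib

/-!
# `NoHeavyLowerTail` (stmt-CriticalPhenomena-4575) — the crux from the DOUBLY-DETHRONED informative gluing step only

Support file (prover `prim-hp-5`, hull-port cell, T-form calculus, gen 7; `--supports stmt-CriticalPhenomena-4575`).  No definitions,
no named facts, no sorries.  Two more cases of the residual gluing hypothesis `hGlue` of `Theorems.noHeavyLowerTail_of_gluedChampion_open`
are theorems: (i) a member `y ∈ B` WITHOUT a positive pair can be dropped (`gluedSet_lsp_of_isolatedMember`: off a null set the glued set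
`B` and `B ∖ y` have the same cluster), after which the induction hypothesis at the smaller set applies; (ii) if the champion `q` is still
a champion of `u_y` = `w` without the pairs at some member `y` (with a positive pair), then `q` itself is an admissible reference on every
star of `y` (`Theorems.gluedSet_lsp_of_subchampion` with `p = q`).  Hence the crux follows from the gluing step restricted to the
DOUBLY-DETHRONED informative instances: every member has a positive pair, gluing `B` dethrones `q`, and `q` is a champion of NO `u_y`
(`noHeavyLowerTail_of_ddGluedChampion`).  Seat census (memo OBSERVER-SET.md §20, lab y20/y35): such instances are rare (≈ 0.3% of the
informative ones) and the certificate REF3 (`Theorems.noHeavyLowerTail_of_ref3Certificate`) holds at all of them.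
-/

noncomputable section

namespace Summit.CriticalPhenomena.PercolationContinuityZ3.Theorems

open MeasureTheory Set Literature.Probability.LatticeModels Literature.Probability.Percolation
open scoped Classical BigOperators

variable {n : ℕ}

/-- **Dropping an isolated member.**  If `y ∈ B` has no positive pair, then LSP(w, q, c, B ∖ y) implies LSP(w, q, c, B) (`q` a relay):
off the null event that a weight-`0` pair is open, `y` is joined to nothing, so the relays joined to `B` are those joined to `B ∖ y` and
`q ≁ B ⟺ q ≁ B ∖ y`. [folklore] -/
theorem gluedSet_lsp_of_isolatedMember (w : Sym2 (Fin n) → unitInterval) (A B : Finset (Fin n)) (y q c : Fin n) (j : ℕ)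
    (hqA : q ∈ A) (hyA : y ∉ A) (hiso : ∀ v, v ≠ y → w s(y, v) = 0)
    (hB' : (prodBernoulli w).real {ω : BondConfig (Fin n) | (∀ m ∈ B.erase y, ω ∉ openConn q m) ∧
        1 ≤ (A.filter fun z => ∃ m ∈ B.erase y, ω ∈ openConn m z).card ∧ (A.filter fun z => ∃ m ∈ B.erase y, ω ∈ openConn m z).card ≤ j} +
      (prodBernoulli w).real {ω : BondConfig (Fin n) | ¬ 1 ≤ (A.filter fun z => ∃ m ∈ B.erase y, ω ∈ openConn m z).card ∧
        (A.filter fun z => ω ∈ openConn c z).card ≤ j} ≤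
      (prodBernoulli w).real {ω : BondConfig (Fin n) | (∀ m ∈ B.erase y, ω ∉ openConn q m) ∧ (A.filter fun z => ω ∈ openConn q z).card ≤ j}) :
    (prodBernoulli w).real {ω : BondConfig (Fin n) | (∀ m ∈ B, ω ∉ openConn q m) ∧
        1 ≤ (A.filter fun z => ∃ m ∈ B, ω ∈ openConn m z).card ∧ (A.filter fun z => ∃ m ∈ B, ω ∈ openConn m z).card ≤ j} +
      (prodBernoulli w).real {ω : BondConfig (Fin n) | ¬ 1 ≤ (A.filter fun z => ∃ m ∈ B, ω ∈ openConn m z).card ∧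
        (A.filter fun z => ω ∈ openConn c z).card ≤ j} ≤
      (prodBernoulli w).real {ω : BondConfig (Fin n) | (∀ m ∈ B, ω ∉ openConn q m) ∧ (A.filter fun z => ω ∈ openConn q z).card ≤ j} := by
  haveI : IsProbabilityMeasure (prodBernoulli w) := inferInstance
  set μ := prodBernoulli w with hμ
  -- on the support event, `y` is joined to no other vertex
  have hnoreach : ∀ ω : BondConfig (Fin n), (∀ e ∈ ω, w e ≠ 0) → ∀ z, z ≠ y → ω ∉ openConn y z := by
    intro ω hω z hzy hreach
    have hreach' : (openGraph ω).Reachable y z := hreach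
    obtain ⟨p⟩ := hreach'
    cases p with
    | nil => exact hzy rfl
    | cons hadj tail =>
      rename_i v
      have hv : s(y, v) ∈ ω ∧ y ≠ v := (openGraph_adj ω y v).1 hadj
      exact hω _ hv.1 (hiso v hv.2.symm)
  have hNB : ∀ ω : BondConfig (Fin n), (∀ e ∈ ω, w e ≠ 0) →
      (A.filter fun z => ∃ m ∈ B, ω ∈ openConn m z) = (A.filter fun z => ∃ m ∈ B.erase y, ω ∈ openConn m z) := by
    intro ω hω
    refine Finset.filter_congr fun z hz => ⟨fun ⟨m, hm, hmz⟩ => ?_, fun ⟨m, hm, hmz⟩ => ⟨m, Finset.mem_of_mem_erase hm, hmz⟩⟩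
    by_cases hmy : m = y
    · subst hmy
      exact absurd hmz (hnoreach ω hω z (fun h => hyA (h ▸ hz)))
    · exact ⟨m, Finset.mem_erase.2 ⟨hmy, hm⟩, hmz⟩
  have hqB : ∀ ω : BondConfig (Fin n), (∀ e ∈ ω, w e ≠ 0) →
      ((∀ m ∈ B, ω ∉ openConn q m) ↔ (∀ m ∈ B.erase y, ω ∉ openConn q m)) := by
    intro ω hω
    refine ⟨fun h m hm => h m (Finset.mem_of_mem_erase hm), fun h m hm hqm => ?_⟩
    by_cases hmy : m = y
    · subst hmy
      have hmq : (openGraph ω).Reachable m q := (show (openGraph ω).Reachable q m from hqm).symm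
      exact hnoreach ω hω q (fun h' => hyA (h' ▸ hqA)) hmq
    · exact h m (Finset.mem_erase.2 ⟨hmy, hm⟩) hqm
  have h1 : μ.real {ω : BondConfig (Fin n) | (∀ m ∈ B, ω ∉ openConn q m) ∧
      1 ≤ (A.filter fun z => ∃ m ∈ B, ω ∈ openConn m z).card ∧ (A.filter fun z => ∃ m ∈ B, ω ∈ openConn m z).card ≤ j} =
      μ.real {ω : BondConfig (Fin n) | (∀ m ∈ B.erase y, ω ∉ openConn q m) ∧
      1 ≤ (A.filter fun z => ∃ m ∈ B.erase y, ω ∈ openConn m z).card ∧ (A.filter fun z => ∃ m ∈ B.erase y, ω ∈ openConn m z).card ≤ j} := by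
    refine WitnessSeparated.measureReal_congr_support w fun ω hω => ?_
    simp only [mem_setOf_eq, hNB ω hω, hqB ω hω]
  have h2 : μ.real {ω : BondConfig (Fin n) | ¬ 1 ≤ (A.filter fun z => ∃ m ∈ B, ω ∈ openConn m z).card ∧
      (A.filter fun z => ω ∈ openConn c z).card ≤ j} = μ.real {ω : BondConfig (Fin n) | ¬ 1 ≤ (A.filter fun z => ∃ m ∈ B.erase y, ω ∈ openConn m z).card ∧
      (A.filter fun z => ω ∈ openConn c z).card ≤ j} := by
    refine WitnessSeparated.measureReal_congr_support w fun ω hω => ?_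
    simp only [mem_setOf_eq, hNB ω hω]
  have h3 : μ.real {ω : BondConfig (Fin n) | (∀ m ∈ B, ω ∉ openConn q m) ∧ (A.filter fun z => ω ∈ openConn q z).card ≤ j} =
      μ.real {ω : BondConfig (Fin n) | (∀ m ∈ B.erase y, ω ∉ openConn q m) ∧ (A.filter fun z => ω ∈ openConn q z).card ≤ j} := by
    refine WitnessSeparated.measureReal_congr_support w fun ω hω => ?_
    simp only [mem_setOf_eq, hqB ω hω]
  rw [h1, h2, h3]
  exact hB'

/-- **The crux from the DOUBLY-DETHRONED informative gluing step.**  `NoHeavyLowerTail` follows from the gluing step of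
`noHeavyLowerTail_of_gluedChampion_open` restricted to instances where every member of `B` has a positive pair, gluing `B` dethrones
`q` (`μ(G_q) < μ(G_a)` for some relay `a`), and for EVERY member `y`, `q` is not a champion of `w` without the pairs at `y` (some relay
is strictly lighter there).  [cite: KozmaNitzan2024, Lemma 5 (p. 13)] -/
theorem noHeavyLowerTail_of_ddGluedChampion
    (hGlueDD : ∀ (n : ℕ) (w : Sym2 (Fin n) → unitInterval) (A B : Finset (Fin n)) (q c : Fin n) (j : ℕ),
      (∀ (n' : ℕ) (w' : Sym2 (Fin n') → unitInterval) (A' B' : Finset (Fin n')) (q' c' : Fin n') (j' : ℕ),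
        (Finset.univ.filter fun e : Sym2 (Fin n') => w' e ≠ 0).card < (Finset.univ.filter fun e : Sym2 (Fin n) => w e ≠ 0).card →
        q' ∈ A' → c' ∈ A' → B'.Nonempty → (∀ m ∈ B', m ∉ A') →
        (∀ a ∈ A', (prodBernoulli w').real {ω : BondConfig (Fin n') | (A'.filter fun x => ω ∈ openConn a x).card ≤ j'} ≤
          (prodBernoulli w').real {ω : BondConfig (Fin n') | (A'.filter fun x => ω ∈ openConn q' x).card ≤ j'}) →
        (prodBernoulli w').real {ω : BondConfig (Fin n') | (∀ m ∈ B', ω ∉ openConn q' m) ∧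
            1 ≤ (A'.filter fun z => ∃ m ∈ B', ω ∈ openConn m z).card ∧ (A'.filter fun z => ∃ m ∈ B', ω ∈ openConn m z).card ≤ j'} +
          (prodBernoulli w').real {ω : BondConfig (Fin n') | ¬ 1 ≤ (A'.filter fun z => ∃ m ∈ B', ω ∈ openConn m z).card ∧
            (A'.filter fun z => ω ∈ openConn c' z).card ≤ j'} ≤
        (prodBernoulli w').real {ω : BondConfig (Fin n') | (∀ m ∈ B', ω ∉ openConn q' m) ∧ (A'.filter fun z => ω ∈ openConn q' z).card ≤ j'}) →
      q ∈ A → c ∈ A → 2 ≤ B.card → (∀ y ∈ B, y ∉ A) →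
      (∀ a ∈ A, (prodBernoulli w).real {ω : BondConfig (Fin n) | (A.filter fun x => ω ∈ openConn a x).card ≤ j} ≤
        (prodBernoulli w).real {ω : BondConfig (Fin n) | (A.filter fun x => ω ∈ openConn q x).card ≤ j}) →
      (∀ y ∈ B, (prodBernoulli w).real {ω : BondConfig (Fin n) | (A.filter fun x => ω ∈ openConn q x).card ≤ j} <
        (prodBernoulli w).real {ω : BondConfig (Fin n) | (A.filter fun x => ω ∈ openConn y x).card ≤ j}) →
      (∀ y ∈ B, ∃ v, v ≠ y ∧ w s(y, v) ≠ 0) →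
      (∃ a ∈ A, (prodBernoulli w).real {ω : BondConfig (Fin n) |
          ((∃ m ∈ B, ω ∈ openConn q m) → (A.filter fun z => ∃ m ∈ B, ω ∈ openConn m z).card ≤ j) ∧
            ((∀ m ∈ B, ω ∉ openConn q m) → (A.filter fun z => ω ∈ openConn q z).card ≤ j)} <
        (prodBernoulli w).real {ω : BondConfig (Fin n) |
          ((∃ m ∈ B, ω ∈ openConn a m) → (A.filter fun z => ∃ m ∈ B, ω ∈ openConn m z).card ≤ j) ∧
            ((∀ m ∈ B, ω ∉ openConn a m) → (A.filter fun z => ω ∈ openConn a z).card ≤ j)}) →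
      (∀ y ∈ B, ∃ a ∈ A, (prodBernoulli fun e => if e ∈ {e : Sym2 (Fin n) | y ∉ e} then w e else 0).real
            {ξ : BondConfig (Fin n) | (A.filter fun z => ξ ∈ openConn q z).card ≤ j} <
          (prodBernoulli fun e => if e ∈ {e : Sym2 (Fin n) | y ∉ e} then w e else 0).real
            {ξ : BondConfig (Fin n) | (A.filter fun z => ξ ∈ openConn a z).card ≤ j}) →
      (prodBernoulli w).real {ω : BondConfig (Fin n) |
          (∀ y ∈ B, ω ∉ openConn q y) ∧
            1 ≤ (A.filter fun z => ∃ y ∈ B, ω ∈ openConn y z).card ∧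
            (A.filter fun z => ∃ y ∈ B, ω ∈ openConn y z).card ≤ j} +
        (prodBernoulli w).real {ω : BondConfig (Fin n) |
          ¬ 1 ≤ (A.filter fun z => ∃ y ∈ B, ω ∈ openConn y z).card ∧
            (A.filter fun z => ω ∈ openConn c z).card ≤ j} ≤
      (prodBernoulli w).real {ω : BondConfig (Fin n) |
          (∀ y ∈ B, ω ∉ openConn q y) ∧ (A.filter fun z => ω ∈ openConn q z).card ≤ j}) :
    Summit.CriticalPhenomena.PercolationContinuityZ3.Theses.PercNearOneGluing.NoHeavyLowerTail := by
  refine noHeavyLowerTail_of_gluedChampion_open fun n w A B q c j ih hq hc hB hBA hch hl => ?_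
  have ih' : ∀ (n' : ℕ) (w' : Sym2 (Fin n') → unitInterval) (A' B' : Finset (Fin n')) (q' c' : Fin n') (j' : ℕ),
      (Finset.univ.filter fun e : Sym2 (Fin n') => w' e ≠ 0).card < (Finset.univ.filter fun e : Sym2 (Fin n) => w e ≠ 0).card →
      q' ∈ A' → c' ∈ A' → B'.Nonempty → (∀ m ∈ B', m ∉ A') →
      (∀ a ∈ A', (prodBernoulli w').real {ω : BondConfig (Fin n') | (A'.filter fun x => ω ∈ openConn a x).card ≤ j'} ≤
        (prodBernoulli w').real {ω : BondConfig (Fin n') | (A'.filter fun x => ω ∈ openConn q' x).card ≤ j'}) →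
      (prodBernoulli w').real {ω : BondConfig (Fin n') | (∀ m ∈ B', ω ∉ openConn q' m) ∧
          1 ≤ (A'.filter fun z => ∃ m ∈ B', ω ∈ openConn m z).card ∧ (A'.filter fun z => ∃ m ∈ B', ω ∈ openConn m z).card ≤ j'} +
        (prodBernoulli w').real {ω : BondConfig (Fin n') | ¬ 1 ≤ (A'.filter fun z => ∃ m ∈ B', ω ∈ openConn m z).card ∧
          (A'.filter fun z => ω ∈ openConn c' z).card ≤ j'} ≤
      (prodBernoulli w').real {ω : BondConfig (Fin n') | (∀ m ∈ B', ω ∉ openConn q' m) ∧ (A'.filter fun z => ω ∈ openConn q' z).card ≤ j'} :=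
    fun n' w' A' B' q' c' j' hlt hq' hc' hB' hBA' hch' => ih n' w' A' B' q' c' j' (Or.inl hlt) hq' hc' hB' hBA' hch'
  by_cases hall : ∀ y ∈ B, ∃ v, v ≠ y ∧ w s(y, v) ≠ 0
  · obtain ⟨y₀, hy₀⟩ : B.Nonempty := Finset.card_pos.1 (by omega)
    have hpos : ∃ y ∈ B, ∃ v, v ≠ y ∧ w s(y, v) ≠ 0 := ⟨y₀, hy₀, hall y₀ hy₀⟩
    by_cases hinf : ∃ a ∈ A, (prodBernoulli w).real {ω : BondConfig (Fin n) |
          ((∃ m ∈ B, ω ∈ openConn q m) → (A.filter fun z => ∃ m ∈ B, ω ∈ openConn m z).card ≤ j) ∧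
            ((∀ m ∈ B, ω ∉ openConn q m) → (A.filter fun z => ω ∈ openConn q z).card ≤ j)} <
        (prodBernoulli w).real {ω : BondConfig (Fin n) |
          ((∃ m ∈ B, ω ∈ openConn a m) → (A.filter fun z => ∃ m ∈ B, ω ∈ openConn m z).card ≤ j) ∧
            ((∀ m ∈ B, ω ∉ openConn a m) → (A.filter fun z => ω ∈ openConn a z).card ≤ j)}
    · by_cases hdd : ∀ y ∈ B, ∃ a ∈ A, (prodBernoulli fun e => if e ∈ {e : Sym2 (Fin n) | y ∉ e} then w e else 0).real
            {ξ : BondConfig (Fin n) | (A.filter fun z => ξ ∈ openConn q z).card ≤ j} <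
          (prodBernoulli fun e => if e ∈ {e : Sym2 (Fin n) | y ∉ e} then w e else 0).real
            {ξ : BondConfig (Fin n) | (A.filter fun z => ξ ∈ openConn a z).card ≤ j}
      · -- doubly dethroned: the hypothesis
        exact hGlueDD n w A B q c j ih' hq hc hB hBA hch hl hall hinf hdd
      · -- `q` is still a champion without the pairs at some member `y`: reference `q` on every star of `y`
        push Not at hdd
        obtain ⟨y, hyB, hych⟩ := hdd
        exact gluedSet_lsp_of_subchampion w A B y q q c j ih' hq hc hBA hyB hB (hall y hyB) hq hych le_rfl
    · -- `q` is a champion of the glued lightness: the non-informative gluing step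
      push Not at hinf
      exact gluedSet_lsp_of_gluedChampion w A B q c j ih' hq hc hBA hB hpos hinf
  · -- a member without a positive pair: drop it and use the induction hypothesis at the smaller set
    push Not at hall
    obtain ⟨y, hyB, hy⟩ := hall
    have hiso : ∀ v, v ≠ y → w s(y, v) = 0 := fun v hvy => hy v hvy
    have hB'ne : (B.erase y).Nonempty := by
      rw [← Finset.card_pos, Finset.card_erase_of_mem hyB]; omega
    have hlt : (B.erase y).card < B.card := Finset.card_erase_lt_of_mem hyB
    have hIH := ih n w A (B.erase y) q c j (Or.inr ⟨le_rfl, hlt⟩) hq hc hB'ne (fun m hm => hBA m (Finset.mem_of_mem_erase hm)) hch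
    exact gluedSet_lsp_of_isolatedMember w A B y q c j hq (hBA y hyB) hiso hIH

end Summit.CriticalPhenomena.PercolationContinuityZ3.Theorems

end
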